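import Mathlib
import HarnessLib
import Summits.KontsevichZagierPeriods.KontsevichZagierPeriods.Theorems.FurushoPentagonKernelModuloPeriodConjectureLeafWeightNineDepth

/-!
# `KernelModuloPeriodConjecture`, line `Sketch`: the algebraic leaf in weight 9

Part: assembly.

Crux `FurushoPentagon.KernelModuloPeriodConjecture` (stmt-KontsevichZagierPeriods-15058), line
`Sketch`, registered stub `stub_leafWeightNine` (the weight-`9` slice of the algebraic leaf
`AssociatorHoffmanSpanning`: Hoffman words span `𝒪(GroupLike ∩ Pent)` weight by weight, the
coordinate form of `GRT₁ ≅ U^{dR}_{MT(ℤ)}`; `d_9 = 5`).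

Method (lead c2; product-free generator `work/gen` in the folder of
prover-line-stmt-KontsevichZagierPeriods-15058-c2): the unknowns are the `2^8` coefficients
`c_w(φ)`, `w ∈ {x₀,x₁}^8x₁`, of a group-like solution `φ` of Drinfeld's pentagon over a commutative
`ℚ`-algebra; the rows are (i) the `x₁`-shuffle regularisation `0 = Σ_{w ∈ x₁ ш v} c_w`
(group-likeness, `c_{x₁} = 0`), (ii) DUALITY `c_{τ(w)} = (-1)^9 c_w` (`τ` = reverse and exchange
letters; Furusho's 2-cycle relation + the antipode of the shuffle Hopf algebra,
`DrinfeldPentagon.apply_reverse_map_not`), (iii) Furusho's regularised stuffle `π_Y(φ)(s) π_Y(φ)(t)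
= Σ_{u ∈ s∗t} π_Y(φ)(u)` (`s` admissible, `t` with positive entries;
`DrinfeldPentagon.piY_mul_piY_eq_sum_stuffle`) minus the shuffle expansion of the same product
(finite/extended double shuffle, linear in the unknowns), or with `t = (1,…,1)` (Hoffman type). The
system has corank `d_9` with the Hoffman words free (Ihara–Kaneko–Zagier's verification of their
Conjecture 1 in this weight, here for abstract pentagon solutions); certificates are exact rational
linear algebra, denominators cleared, checked by `linear_combination`.

References: K. Ihara, M. Kaneko, D. Zagier, Compos. Math. 142 (2006) §2 [IharaKanekoZagier2006]; H.
Furusho, Ann. of Math. 174 (2011) Thm 1.2, §5 [Furusho2011]; H. Furusho, Ann. of Math. 171 (2010)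
Lemma 6 [Furusho2010]; F. Brown, Ann. of Math. 175 (2012) Thm 1.1 [Brown2012].
-/

namespace Summit.KontsevichZagierPeriods.FurushoPentagon.KernelModuloPeriodConjecture

open Literature.NumberTheory.Transcendental
open MZV (binaryWord)

/-- **The algebraic leaf `AssociatorHoffmanSpanning` in weight `9`**: for every admissible index `s`
of weight `9` one finitely supported `b` on Hoffman indices of weight `9` with `c_{binaryWord s}(φ)
= Σ_t b_t c_{binaryWord t}(φ)` at every group-like solution `φ` of Drinfeld's pentagon over every
(reduced) commutative `ℚ`-algebra — the weight-`9` slice of `GRT₁ ≅ U^{dR}_{MT(ℤ)}` in coordinates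
(`d_9 = 5`; reducedness is not used). [cite: IharaKanekoZagier2006, §2] -/
theorem associatorHoffmanSpanning_of_weight_eq_9 {s : List ℕ} (hs : MZV.IsAdmissible s)
    (hw : MZV.weight s = 9) :
    ∃ b : List ℕ →₀ ℚ, (∀ t ∈ b.support, MZV.IsHoffman t ∧ MZV.weight t = MZV.weight s) ∧ ∀ (R :
      Type) [CommRing R] [Algebra ℚ R] [IsReduced R] (φ : NCSeries Bool R), NCSeries.IsGroupLike φ →
      NCSeries.DrinfeldPentagon φ → φ (MZV.binaryWord s) = b.sum (fun t q => q • φ (MZV.binaryWord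
      t)) := by
  obtain ⟨hpos, hhead⟩ := hs
  match s, hpos, hhead, hw with
  | [], _, _, hw => exact absurd hw (by decide)
  | [n1], hpos, hhead, hw =>
    have hn1 : 2 ≤ n1 := hhead (by simp)
    have hw' : n1 = 9 := by simpa [MZV.weight] using hw
    exact leafW9_depth1 n1 hn1 hw'
  | [n1, n2], hpos, hhead, hw =>
    have hn1 : 2 ≤ n1 := hhead (by simp)
    have hn2 : 1 ≤ n2 := hpos n2 (by simp)
    have hw' : n1 + n2 = 9 := by simpa [MZV.weight] using hw
    exact leafW9_depth2 n1 n2 hn1 hn2 hw'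
  | [n1, n2, n3], hpos, hhead, hw =>
    have hn1 : 2 ≤ n1 := hhead (by simp)
    have hn2 : 1 ≤ n2 := hpos n2 (by simp)
    have hn3 : 1 ≤ n3 := hpos n3 (by simp)
    have hw' : n1 + (n2 + n3) = 9 := by simpa [MZV.weight] using hw
    exact leafW9_depth3 n1 n2 n3 hn1 hn2 hn3 hw'
  | [n1, n2, n3, n4], hpos, hhead, hw =>
    have hn1 : 2 ≤ n1 := hhead (by simp)
    have hn2 : 1 ≤ n2 := hpos n2 (by simp)
    have hn3 : 1 ≤ n3 := hpos n3 (by simp)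
    have hn4 : 1 ≤ n4 := hpos n4 (by simp)
    have hw' : n1 + (n2 + (n3 + n4)) = 9 := by simpa [MZV.weight] using hw
    exact leafW9_depth4 n1 n2 n3 n4 hn1 hn2 hn3 hn4 hw'
  | [n1, n2, n3, n4, n5], hpos, hhead, hw =>
    have hn1 : 2 ≤ n1 := hhead (by simp)
    have hn2 : 1 ≤ n2 := hpos n2 (by simp)
    have hn3 : 1 ≤ n3 := hpos n3 (by simp)
    have hn4 : 1 ≤ n4 := hpos n4 (by simp)
    have hn5 : 1 ≤ n5 := hpos n5 (by simp)
    have hw' : n1 + (n2 + (n3 + (n4 + n5))) = 9 := by simpa [MZV.weight] using hw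
    exact leafW9_depth5 n1 n2 n3 n4 n5 hn1 hn2 hn3 hn4 hn5 hw'
  | [n1, n2, n3, n4, n5, n6], hpos, hhead, hw =>
    have hn1 : 2 ≤ n1 := hhead (by simp)
    have hn2 : 1 ≤ n2 := hpos n2 (by simp)
    have hn3 : 1 ≤ n3 := hpos n3 (by simp)
    have hn4 : 1 ≤ n4 := hpos n4 (by simp)
    have hn5 : 1 ≤ n5 := hpos n5 (by simp)
    have hn6 : 1 ≤ n6 := hpos n6 (by simp)
    have hw' : n1 + (n2 + (n3 + (n4 + (n5 + n6)))) = 9 := by simpa [MZV.weight] using hw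
    exact leafW9_depth6 n1 n2 n3 n4 n5 n6 hn1 hn2 hn3 hn4 hn5 hn6 hw'
  | [n1, n2, n3, n4, n5, n6, n7], hpos, hhead, hw =>
    have hn1 : 2 ≤ n1 := hhead (by simp)
    have hn2 : 1 ≤ n2 := hpos n2 (by simp)
    have hn3 : 1 ≤ n3 := hpos n3 (by simp)
    have hn4 : 1 ≤ n4 := hpos n4 (by simp)
    have hn5 : 1 ≤ n5 := hpos n5 (by simp)
    have hn6 : 1 ≤ n6 := hpos n6 (by simp)
    have hn7 : 1 ≤ n7 := hpos n7 (by simp)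
    have hw' : n1 + (n2 + (n3 + (n4 + (n5 + (n6 + n7))))) = 9 := by simpa [MZV.weight] using hw
    exact leafW9_depth7 n1 n2 n3 n4 n5 n6 n7 hn1 hn2 hn3 hn4 hn5 hn6 hn7 hw'
  | [n1, n2, n3, n4, n5, n6, n7, n8], hpos, hhead, hw =>
    have hn1 : 2 ≤ n1 := hhead (by simp)
    have hn2 : 1 ≤ n2 := hpos n2 (by simp)
    have hn3 : 1 ≤ n3 := hpos n3 (by simp)
    have hn4 : 1 ≤ n4 := hpos n4 (by simp)
    have hn5 : 1 ≤ n5 := hpos n5 (by simp)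
    have hn6 : 1 ≤ n6 := hpos n6 (by simp)
    have hn7 : 1 ≤ n7 := hpos n7 (by simp)
    have hn8 : 1 ≤ n8 := hpos n8 (by simp)
    have hw' : n1 + (n2 + (n3 + (n4 + (n5 + (n6 + (n7 + n8)))))) = 9 := by simpa [MZV.weight] using
      hw
    exact leafW9_depth8 n1 n2 n3 n4 n5 n6 n7 n8 hn1 hn2 hn3 hn4 hn5 hn6 hn7 hn8 hw'
  | n1 :: n2 :: n3 :: n4 :: n5 :: n6 :: n7 :: n8 :: n9 :: u, hpos, hhead, hw =>
    exfalso
    have hn1 : 2 ≤ n1 := hhead (by simp)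
    have hn2 : 1 ≤ n2 := hpos n2 (by simp)
    have hn3 : 1 ≤ n3 := hpos n3 (by simp)
    have hn4 : 1 ≤ n4 := hpos n4 (by simp)
    have hn5 : 1 ≤ n5 := hpos n5 (by simp)
    have hn6 : 1 ≤ n6 := hpos n6 (by simp)
    have hn7 : 1 ≤ n7 := hpos n7 (by simp)
    have hn8 : 1 ≤ n8 := hpos n8 (by simp)
    have hn9 : 1 ≤ n9 := hpos n9 (by simp)
    have hw' : n1 + (n2 + (n3 + (n4 + (n5 + (n6 + (n7 + (n8 + (n9 + u.sum)))))))) = 9 := by simpa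
      [MZV.weight] using hw
    omega

/-- **Registered stub `stub_leafWeightNine`** of the lead's skeleton (crux
stmt-KontsevichZagierPeriods-15058, line `Sketch`): the weight-`9` slice of the algebraic leaf
`AssociatorHoffmanSpanning`, verbatim. [cite: IharaKanekoZagier2006, §2] -/
theorem stub_leafWeightNine : ∀ s : List ℕ, MZV.IsAdmissible s → MZV.weight s = 9 → ∃ b : List ℕ →₀
    ℚ, (∀ t ∈ b.support, MZV.IsHoffman t ∧ MZV.weight t = MZV.weight s) ∧ ∀ (R : Type) [CommRing R]
    [Algebra ℚ R] [IsReduced R] (φ : NCSeries Bool R), NCSeries.IsGroupLike φ →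
    NCSeries.DrinfeldPentagon φ → φ (MZV.binaryWord s) = b.sum (fun t q => q • φ (MZV.binaryWord t))
    :=
  fun _ hs hw => associatorHoffmanSpanning_of_weight_eq_9 hs hw

end Summit.KontsevichZagierPeriods.FurushoPentagon.KernelModuloPeriodConjecture
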